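import Summits.QuantumFields.BalabanUV.Beta.GAN24.T2UnitSplitLevels

/-!
# `BalabanUV.Beta.GAN24.T2UnitSplitShapes` — binder row G-an2-4 / (CONV-C), W-slot, road «W3» (F1): THE LEVEL SUMS OF THE NORMALISED
# T₂ FAMILY WITH EVERY PER-LEVEL DATUM DISCHARGED FROM THE TREE — (F1) MODULO THE MIXED-TABLE SHAPE ONLY
# (G-an2-4 FORMAL swarm, leaf-01 lineage, gen 14; part 4 of «W3-L1 T2SPLIT*»)

NOT IN PRINT; OUR BOOKKEEPING.  HONEST FRAMING (cell contract, verbatim): «discharging `BetaPertH` makes Bałaban's UV stability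
UNCONDITIONAL — a real constructive-QFT result; it is NOT the continuum limit and NOT the Clay problem.»  HONEST DEPENDENCY (verbatim):
«continuum YM on T⁴ ⇐ BetaPertH ∧ nine spine estimates (0/9 proved); BetaPertH ⇐ (D1) ∧ (D4) ∧ CAP+tail; G-an2-4 gates asym, D1 and
NE2/3/4.»

WHAT.  `T2UnitSplitLevels.unitS₂_T2Of_eq_transport_add_sum` (the (F1) `hsplit` of the row owner's `WSlotT2OfPieces` ENDs) takes, per level `j`,
leaf-04's step data `hdat` (decay of the normalised kernel `K♮_j` and the `VertexFamily₂` shape of the normalised second-order member and of its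
`T♮`-free part, at one rate) and bounded entries `hbdd` of the normalised member `T♮_j`.  Here both are DISCHARGED FROM TREE THEOREMS:
§3 `bdd₄_of_locStencil₂`, `bdd₄_unitS₂`, **`step_data_of_shapes`** (an4's `OneStepKernelFamily.decays_KInvStep` in units by
`HessKerDressedUnits.decays_unitK`; an2's `BalabanStepW2.vertexFamily₂_WbalOf'` over `T2Of_loc` — and over the ZERO bi-table family for the
`T♮`-free part — moved to units by `SecondOrderUnits.unitW_WbalOf` + `vertexFamily₂_unitW`; the three rates merged by `decays_mono` /
`vertexFamily₂_mono`), **`bdd₄_unitS₂_T2Of_of_shapes`** (an2's `T2Of_loc`); §4 the level sums MODULO THE SHAPES ONLY: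
**`unitS₂_T2Of_eq_transport_add_sum_of_shapes`** (generic off-diagonal border table: modulo its shape `hB` and `hmix`),
**`unitS₂_T2Of_eq_transport_add_sum_vh₂S_of_mix`** and **`unitS₂_T2Of_sub_eq_transport_add_sum_vh₂S_of_mix`** (an1's `vh₂S d Lc`, border shape
by leaf-19's `T2SlotUnits.locStencil₂_vh₂S`: MODULO `hmix : ∃ C δ, 0 < δ ∧ LocStencilFM Lc mixFF C δ` ALONE — the mixed-table shape, the W-slot's
one-line packaging item of SKELETON-W3 §6) = the `hsplit` texts of `t2Shape_of_rows` / `t2Drift_of_rows`.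
[folklore] composition of tree theorems; every constant per level EXISTENTIAL; asserts NO j-uniform bound, NO zero mode, NO sum rule;
«T2Shape»/«T2SupRate» OPEN, NOT IN PRINT; discharges NOTHING of (hW, hWall); NOT «W-slot closed», NEVER «G-an2-4 closed»; NOT BetaPertH,
NOT continuum, NOT Clay.
-/

noncomputable section

open Finset
open scoped BigOperators
open Literature.MathematicalPhysics.QuantumFieldTheory
open Literature.MathematicalPhysics.QuantumFieldTheory.Balaban1983to89
open Literature.MathematicalPhysics.QuantumFieldTheory.Balaban1983to89.Beta
open B12Sec2to5 (l1 l1_nonneg)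
open ExpKernelCalculus (MKer Decays VertexFamily₂)
open OneStepResolventKernel (Fib decays_mono)
open OneStepKernelFamily (KInvStep decays_KInvStep)
open StepJetData (mfNeg)
open SecondOrderResponse (W2SymOfK LocStencilFM)
open BalabanCompositeJets (LocStencil₂)
open BalabanStepJets (vertexFamily₂_mono)
open BalabanStepJetsSucc (mmRead)
open BalabanStepW2 (K3OfK Spure M1 M2Of T2Of WbalOf T2Of_loc vertexFamily₂_WbalOf')
open AveragingMixedJetTables (vh₂S)
open KernelWard (bdd_of_biLoc)
open Summit.QuantumFields.BalabanUV.Beta.HessKerDressedUnits (unitK unitS unitW legScale abs_legScale_le decays_unitK vertexFamily₂_unitW)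
open Summit.QuantumFields.BalabanUV.Beta.SecondOrderUnits (unitM unitS₂ unitM₂ unitW_WbalOf)
open Summit.QuantumFields.BalabanUV.Beta.GAN24.CombesThomas (sfStep smStep sfStep_ne_zero smStep_ne_zero)
open Summit.QuantumFields.BalabanUV.Beta.GAN24.T2SlotUnits (unitS₂_apply vh₂S_inl_inl vh₂S_inr_inr locStencil₂_vh₂S)
open Summit.QuantumFields.BalabanUV.Beta.GAN24.T2RecursionAffine (lin4)
open Summit.QuantumFields.BalabanUV.Beta.GAN24.AffineUnroll (transport)
open Summit.QuantumFields.BalabanUV.Beta.GAN24.T2UnitSplitLevels (unitS₂_T2Of_eq_transport_add_sum unitS₂_T2Of_sub_eq_transport_add_sum)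

namespace Summit.QuantumFields.BalabanUV.Beta.GAN24.T2UnitSplitShapes

variable {d : ℕ}

/-! ## §3 The per-level data FROM TREE THEOREMS: `hsplit` modulo the border shape and the mixed-table shape only -/

section Data

variable {Lc : ℕ} [NeZero Lc]

/-- [folklore] A `LocStencil₂` family (rate `δ ≥ 0`) has entries bounded by its constant. -/
theorem bdd₄_of_locStencil₂ {X : Fin (d + 1) → (Fin (d + 1) → ℤ) → Fin (d + 1) → (Fin (d + 1) → ℤ) → MKer (d + 1) (Fib d)}
    {C δ : ℝ} (h : LocStencil₂ X C δ) (hδ : 0 ≤ δ) : ∃ B : ℝ, ∀ κ u κ' u' x z a b, |X κ u κ' u' x z a b| ≤ B := by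
  refine ⟨C, fun κ u κ' u' x z a b => ?_⟩
  have h1 := bdd_of_biLoc (h κ u κ' u') hδ x z a b
  have hC : 0 ≤ C := by
    have h0 := (abs_nonneg _).trans h1
    exact nonneg_of_mul_nonneg_left h0 (Real.exp_pos _)
  refine h1.trans ?_
  have he : Real.exp (-δ * l1 (u' - u)) ≤ 1 := Real.exp_le_one_iff.mpr (by nlinarith [l1_nonneg (u' - u)])
  calc C * Real.exp (-δ * l1 (u' - u)) ≤ C * 1 := mul_le_mul_of_nonneg_left he hC
    _ = C := mul_one C

/-- [folklore] The change of units `unitS₂ s_f s_m` preserves bounded entries. -/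
theorem bdd₄_unitS₂ (sf sm : ℝ) {S₂ : Fin (d + 1) → (Fin (d + 1) → ℤ) → Fin (d + 1) → (Fin (d + 1) → ℤ) → MKer (d + 1) (Fib d)}
    (h : ∃ B : ℝ, ∀ κ u κ' u' x z a b, |S₂ κ u κ' u' x z a b| ≤ B) :
    ∃ B : ℝ, ∀ κ u κ' u' x z a b, |unitS₂ sf sm S₂ κ u κ' u' x z a b| ≤ B := by
  obtain ⟨B, hB⟩ := h
  have hB0 : 0 ≤ B := (abs_nonneg _).trans (hB 0 0 0 0 0 0 (Sum.inl 0) (Sum.inl 0))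
  set U : ℝ := max |sf⁻¹| |sm⁻¹|
  have hU : 0 ≤ U := (abs_nonneg _).trans (abs_legScale_le (d := d) sf⁻¹ sm⁻¹ (Sum.inl 0))
  refine ⟨|(sf * sm)⁻¹| * (|(sf * sm)⁻¹| * (U * B * U)), fun κ u κ' u' x z a b => ?_⟩
  rw [unitS₂_apply]
  simp only [abs_mul]
  have h1 : |legScale sf⁻¹ sm⁻¹ a| * |S₂ κ u κ' u' x z a b| ≤ U * B :=
    mul_le_mul (abs_legScale_le sf⁻¹ sm⁻¹ a) (hB κ u κ' u' x z a b) (abs_nonneg _) hU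
  have h2 : |legScale sf⁻¹ sm⁻¹ a| * |S₂ κ u κ' u' x z a b| * |legScale sf⁻¹ sm⁻¹ b| ≤ U * B * U :=
    mul_le_mul h1 (abs_legScale_le sf⁻¹ sm⁻¹ b) (abs_nonneg _) (mul_nonneg hU hB0)
  exact mul_le_mul_of_nonneg_left (mul_le_mul_of_nonneg_left h2 (abs_nonneg _)) (abs_nonneg _)


/-- [folklore] **leaf-04's STEP DATA FROM THE TREE, at a common rate per level**: for every `j` there are constants and ONE rate `δ > 0` with
`Decays K♮_j C δ` (an4's `decays_KInvStep` in units, `decays_unitK`), and the `VertexFamily₂` shape at rate `δ` of the normalised second-order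
member `W2SymOfK K♮_j Lc S♮_j M♮_j T♮_j M₂♮_j` (`= unitW_j (WbalOf … (T2Of …) mixFF j)`, `SecondOrderUnits.unitW_WbalOf`; an2's
`vertexFamily₂_WbalOf'` over `T2Of_loc`, then `vertexFamily₂_unitW`) and of its `T♮`-free part (the same with the ZERO bi-table family) —
given only the border shape `hB` and the mixed-table shape `hmix` (rates merged to the minimum by `decays_mono` / `vertexFamily₂_mono`). -/
theorem step_data_of_shapes (hLc : 1 ≤ Lc) (cE cVH cΛ cE₂ cB : ℝ) (Tc : Fin 4 → Fin 4 → Fin 4 → Fin 4 → ℝ)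
    {vh₂S : Fin (d + 1) → (Fin (d + 1) → ℤ) → Fin (d + 1) → (Fin (d + 1) → ℤ) → MKer (d + 1) (Fib d)}
    (hB : ∃ C δ : ℝ, 0 < δ ∧ LocStencil₂ vh₂S C δ)
    {mixFF : Fin (d + 1) → (Fin (d + 1) → ℤ) → Fin (d + 1) → (Fin (d + 1) → ℤ) → MKer (d + 1) (Fib d)}
    (hmix : ∃ C δ : ℝ, 0 < δ ∧ LocStencilFM Lc mixFF C δ) (j : ℕ) :
    ∃ C δ C₀ C₁ : ℝ, 0 < δ ∧ Decays (unitK (sfStep Lc j) (smStep d Lc j) (KInvStep (d := d) Lc j)) C δ ∧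
      VertexFamily₂ (W2SymOfK (unitK (sfStep Lc j) (smStep d Lc j) (KInvStep (d := d) Lc j)) Lc
        (unitS (sfStep Lc j) (smStep d Lc j) (Spure d Lc cE cVH cΛ j)) (unitM (sfStep Lc j) (smStep d Lc j) (M1 d Lc cΛ j)) 0
        (unitM₂ (sfStep Lc j) (smStep d Lc j) (M2Of d Lc mixFF j))) Lc C₀ δ ∧
      VertexFamily₂ (W2SymOfK (unitK (sfStep Lc j) (smStep d Lc j) (KInvStep (d := d) Lc j)) Lc
        (unitS (sfStep Lc j) (smStep d Lc j) (Spure d Lc cE cVH cΛ j)) (unitM (sfStep Lc j) (smStep d Lc j) (M1 d Lc cΛ j))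
        (unitS₂ (sfStep Lc j) (smStep d Lc j) (T2Of d Lc cE cVH cΛ cE₂ cB Tc vh₂S mixFF j))
        (unitM₂ (sfStep Lc j) (smStep d Lc j) (M2Of d Lc mixFF j))) Lc C₁ δ := by
  -- the kernel
  obtain ⟨δK, CK, hδK, -, hK⟩ := decays_KInvStep (Lc := Lc) (d := d) j
  have hKu := decays_unitK (sf := sfStep Lc j) (sm := smStep d Lc j) hK
  -- the full second-order member
  obtain ⟨Cw, δw, hδw, hWb⟩ := vertexFamily₂_WbalOf' hLc cE cVH cΛ (T₂ := T2Of d Lc cE cVH cΛ cE₂ cB Tc vh₂S mixFF)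
    (T2Of_loc hLc cE cVH cΛ cE₂ cB Tc hB hmix) hmix j
  have hW := vertexFamily₂_unitW (sf := sfStep Lc j) (sm := smStep d Lc j) hWb
  rw [unitW_WbalOf d Lc (sfStep_ne_zero j) (smStep_ne_zero j)] at hW
  -- its `T♮`-free part: the same carrier on the ZERO bi-table family
  have hT0 : ∀ j : ℕ, ∃ C δ : ℝ, 0 < δ ∧ LocStencil₂
      ((fun _ : ℕ => (0 : Fin (d + 1) → (Fin (d + 1) → ℤ) → Fin (d + 1) → (Fin (d + 1) → ℤ) → MKer (d + 1) (Fib d))) j) C δ :=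
    fun _ => ⟨0, 1, one_pos, fun κ u κ' u' x y a b => by simp⟩
  obtain ⟨Cw₀, δw₀, hδw₀, hW₀b⟩ := vertexFamily₂_WbalOf' hLc cE cVH cΛ
    (T₂ := fun _ : ℕ => (0 : Fin (d + 1) → (Fin (d + 1) → ℤ) → Fin (d + 1) → (Fin (d + 1) → ℤ) → MKer (d + 1) (Fib d))) hT0 hmix j
  have hW₀ := vertexFamily₂_unitW (sf := sfStep Lc j) (sm := smStep d Lc j) hW₀b
  have e0 : unitS₂ (sfStep Lc j) (smStep d Lc j)
      (0 : Fin (d + 1) → (Fin (d + 1) → ℤ) → Fin (d + 1) → (Fin (d + 1) → ℤ) → MKer (d + 1) (Fib d)) = 0 := by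
    funext κ u κ' u' x z a b
    rw [unitS₂_apply]
    simp
  simp only [unitW_WbalOf d Lc (sfStep_ne_zero j) (smStep_ne_zero j), e0] at hW₀
  -- merge the three rates
  have hCK : 0 ≤ max |sfStep Lc j| |smStep d Lc j| * CK * max |sfStep Lc j| |smStep d Lc j| := hKu.nonneg (Sum.inl 0)
  have hC₁ : 0 ≤ max |(sfStep Lc j)⁻¹| |(smStep d Lc j)⁻¹| * Cw * max |(sfStep Lc j)⁻¹| |(smStep d Lc j)⁻¹| :=
    (hW 0 0 0 0).nonneg (Sum.inl 0)
  have hC₀ : 0 ≤ max |(sfStep Lc j)⁻¹| |(smStep d Lc j)⁻¹| * Cw₀ * max |(sfStep Lc j)⁻¹| |(smStep d Lc j)⁻¹| :=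
    (hW₀ 0 0 0 0).nonneg (Sum.inl 0)
  refine ⟨_, min δK (min δw δw₀), _, _, lt_min hδK (lt_min hδw hδw₀), decays_mono hKu hCK le_rfl (min_le_left _ _),
    vertexFamily₂_mono hW₀ hC₀ ((min_le_right _ _).trans (min_le_right _ _)),
    vertexFamily₂_mono hW hC₁ ((min_le_right _ _).trans (min_le_left _ _))⟩

/-- [folklore] **BOUNDED ENTRIES OF EVERY NORMALISED MEMBER FROM THE TREE** (an2's `T2Of_loc` + `bdd₄_unitS₂`), given `hB`, `hmix`. -/
theorem bdd₄_unitS₂_T2Of_of_shapes (hLc : 1 ≤ Lc) (cE cVH cΛ cE₂ cB : ℝ) (Tc : Fin 4 → Fin 4 → Fin 4 → Fin 4 → ℝ)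
    {vh₂S : Fin (d + 1) → (Fin (d + 1) → ℤ) → Fin (d + 1) → (Fin (d + 1) → ℤ) → MKer (d + 1) (Fib d)}
    (hB : ∃ C δ : ℝ, 0 < δ ∧ LocStencil₂ vh₂S C δ)
    {mixFF : Fin (d + 1) → (Fin (d + 1) → ℤ) → Fin (d + 1) → (Fin (d + 1) → ℤ) → MKer (d + 1) (Fib d)}
    (hmix : ∃ C δ : ℝ, 0 < δ ∧ LocStencilFM Lc mixFF C δ) (j : ℕ) :
    ∃ B : ℝ, ∀ κ u κ' u' x z a b,
      |unitS₂ (sfStep Lc j) (smStep d Lc j) (T2Of d Lc cE cVH cΛ cE₂ cB Tc vh₂S mixFF j) κ u κ' u' x z a b| ≤ B := by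
  obtain ⟨C, δ, hδ, h⟩ := T2Of_loc hLc cE cVH cΛ cE₂ cB Tc hB hmix j
  exact bdd₄_unitS₂ _ _ (bdd₄_of_locStencil₂ h hδ.le)

end Data

/-! ## §4 (F1) MODULO THE SHAPES ONLY: the level sums with every per-level datum discharged from the tree -/

section OfShapes

variable {Lc : ℕ} [NeZero Lc] (cE cVH cΛ cE₂ cB : ℝ) (Tc : Fin 4 → Fin 4 → Fin 4 → Fin 4 → ℝ)
  (mixFF : Fin (d + 1) → (Fin (d + 1) → ℤ) → Fin (d + 1) → (Fin (d + 1) → ℤ) → MKer (d + 1) (Fib d))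


/-- [folklore] **(F1) MODULO `hB` AND `hmix` ONLY** (generic off-diagonal border table): the level sum of
`unitS₂_T2Of_eq_transport_add_sum` with leaf-04's step data and the bounded entries discharged from the tree (`step_data_of_shapes`,
`bdd₄_unitS₂_T2Of_of_shapes`). -/
theorem unitS₂_T2Of_eq_transport_add_sum_of_shapes (hLc : 1 ≤ Lc)
    (Bd : Fin (d + 1) → (Fin (d + 1) → ℤ) → Fin (d + 1) → (Fin (d + 1) → ℤ) → MKer (d + 1) (Fib d))
    (hBff : ∀ κ u κ' u' x z (α β : Fin (d + 1)), Bd κ u κ' u' x z (Sum.inl α) (Sum.inl β) = 0)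
    (hBmm : ∀ κ u κ' u' x z (μ ν : Fin (d + 1)), Bd κ u κ' u' x z (Sum.inr μ) (Sum.inr ν) = 0)
    (hB : ∃ C δ : ℝ, 0 < δ ∧ LocStencil₂ Bd C δ) (hmix : ∃ C δ : ℝ, 0 < δ ∧ LocStencilFM Lc mixFF C δ) (n : ℕ) :
    unitS₂ (sfStep Lc n) (smStep d Lc n) (T2Of d Lc cE cVH cΛ cE₂ cB Tc Bd mixFF n) =
      transport (fun j => lin4 (cE₂ * (Lc : ℝ) ^ (2 * (d + 1))) (unitK (sfStep Lc j) (smStep d Lc j) (KInvStep (d := d) Lc j)) Lc) 0 n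
            (unitS₂ (sfStep Lc 0) (smStep d Lc 0) (T2Of d Lc cE cVH cΛ cE₂ cB Tc Bd mixFF 0)) +
        ∑ i ∈ Finset.range n, transport (fun j => lin4 (cE₂ * (Lc : ℝ) ^ (2 * (d + 1)))
              (unitK (sfStep Lc j) (smStep d Lc j) (KInvStep (d := d) Lc j)) Lc) (i + 1) (n - 1 - i)
              (fun κ u κ' u' => (cE₂ * (Lc : ℝ) ^ (2 * (d + 1))) • mmRead Lc (K3OfK (unitK (sfStep Lc i) (smStep d Lc i) (KInvStep (d := d) Lc i)) Lc
              (unitS (sfStep Lc i) (smStep d Lc i) (Spure d Lc cE cVH cΛ i)) (unitM (sfStep Lc i) (smStep d Lc i) (M1 d Lc cΛ i)) (W2SymOfK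
              (unitK (sfStep Lc i) (smStep d Lc i) (KInvStep (d := d) Lc i)) Lc (unitS (sfStep Lc i) (smStep d Lc i) (Spure d Lc cE cVH cΛ i))
              (unitM (sfStep Lc i) (smStep d Lc i) (M1 d Lc cΛ i)) 0
              (unitM₂ (sfStep Lc i) (smStep d Lc i) (M2Of d Lc mixFF i))) κ u κ' u') + cB • mfNeg (Bd κ u κ' u')) :=
  unitS₂_T2Of_eq_transport_add_sum cE cVH cΛ cE₂ cB Tc Bd mixFF hBff hBmm
    (step_data_of_shapes hLc cE cVH cΛ cE₂ cB Tc hB hmix) (bdd₄_unitS₂_T2Of_of_shapes hLc cE cVH cΛ cE₂ cB Tc hB hmix) n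

/-- [folklore] **(F1) FOR an1's BORDER TABLE MODULO `hmix` ONLY** — THE `hsplit` OF `WSlotT2OfPieces.t2Shape_of_rows` with `P := transport
(fun j ↦ lin4 c₄ K♮_j Lc)`, `b := b♮`, every other input a tree theorem (`locStencil₂_vh₂S` for the border shape). -/
theorem unitS₂_T2Of_eq_transport_add_sum_vh₂S_of_mix (hLc : 1 ≤ Lc) (hmix : ∃ C δ : ℝ, 0 < δ ∧ LocStencilFM Lc mixFF C δ) (n : ℕ) :
    unitS₂ (sfStep Lc n) (smStep d Lc n) (T2Of d Lc cE cVH cΛ cE₂ cB Tc (vh₂S d Lc) mixFF n) =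
      transport (fun j => lin4 (cE₂ * (Lc : ℝ) ^ (2 * (d + 1))) (unitK (sfStep Lc j) (smStep d Lc j) (KInvStep (d := d) Lc j)) Lc) 0 n
            (unitS₂ (sfStep Lc 0) (smStep d Lc 0) (T2Of d Lc cE cVH cΛ cE₂ cB Tc (vh₂S d Lc) mixFF 0)) +
        ∑ i ∈ Finset.range n, transport (fun j => lin4 (cE₂ * (Lc : ℝ) ^ (2 * (d + 1)))
              (unitK (sfStep Lc j) (smStep d Lc j) (KInvStep (d := d) Lc j)) Lc) (i + 1) (n - 1 - i)
              (fun κ u κ' u' => (cE₂ * (Lc : ℝ) ^ (2 * (d + 1))) • mmRead Lc (K3OfK (unitK (sfStep Lc i) (smStep d Lc i) (KInvStep (d := d) Lc i)) Lc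
              (unitS (sfStep Lc i) (smStep d Lc i) (Spure d Lc cE cVH cΛ i)) (unitM (sfStep Lc i) (smStep d Lc i) (M1 d Lc cΛ i)) (W2SymOfK
              (unitK (sfStep Lc i) (smStep d Lc i) (KInvStep (d := d) Lc i)) Lc (unitS (sfStep Lc i) (smStep d Lc i) (Spure d Lc cE cVH cΛ i))
              (unitM (sfStep Lc i) (smStep d Lc i) (M1 d Lc cΛ i)) 0
              (unitM₂ (sfStep Lc i) (smStep d Lc i) (M2Of d Lc mixFF i))) κ u κ' u') + cB • mfNeg ((vh₂S d Lc) κ u κ' u')) :=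
  unitS₂_T2Of_eq_transport_add_sum_of_shapes cE cVH cΛ cE₂ cB Tc mixFF hLc (vh₂S d Lc) (vh₂S_inl_inl Lc) (vh₂S_inr_inr Lc)
    ⟨_, 1, one_pos, locStencil₂_vh₂S hLc zero_le_one⟩ hmix n

/-- [folklore] **(F1) FOR THE DIFFERENCE TOWER, an1's BORDER TABLE, MODULO `hmix` ONLY** — THE `hsplit` OF `WSlotT2OfPieces.t2Drift_of_rows`
with `P m k := transport (fun j ↦ lin4 c₄ K♮_j Lc) (m+1) k` and the forcing `f i := (𝒜_{i+1} − 𝒜_i)[T♮_i] + (b♮_{i+1} − b♮_i)`. -/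
theorem unitS₂_T2Of_sub_eq_transport_add_sum_vh₂S_of_mix (hLc : 1 ≤ Lc) (hmix : ∃ C δ : ℝ, 0 < δ ∧ LocStencilFM Lc mixFF C δ)
    (n : ℕ) :
    (fun κ u κ' u' => unitS₂ (sfStep Lc (n + 1)) (smStep d Lc (n + 1)) (T2Of d Lc cE cVH cΛ cE₂ cB Tc (vh₂S d Lc) mixFF (n + 1)) κ u κ' u' -
        unitS₂ (sfStep Lc n) (smStep d Lc n) (T2Of d Lc cE cVH cΛ cE₂ cB Tc (vh₂S d Lc) mixFF n) κ u κ' u') =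
      transport (fun j => lin4 (cE₂ * (Lc : ℝ) ^ (2 * (d + 1))) (unitK (sfStep Lc j) (smStep d Lc j) (KInvStep (d := d) Lc j)) Lc) 1 n
            (fun κ u κ' u' =>
          unitS₂ (sfStep Lc 1) (smStep d Lc 1) (T2Of d Lc cE cVH cΛ cE₂ cB Tc (vh₂S d Lc) mixFF 1) κ u κ' u' -
            unitS₂ (sfStep Lc 0) (smStep d Lc 0) (T2Of d Lc cE cVH cΛ cE₂ cB Tc (vh₂S d Lc) mixFF 0) κ u κ' u') +
        ∑ i ∈ Finset.range n, transport (fun j => lin4 (cE₂ * (Lc : ℝ) ^ (2 * (d + 1)))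
              (unitK (sfStep Lc j) (smStep d Lc j) (KInvStep (d := d) Lc j)) Lc) (i + 2) (n - 1 - i)
          ((lin4 (cE₂ * (Lc : ℝ) ^ (2 * (d + 1))) (unitK (sfStep Lc (i + 1)) (smStep d Lc (i + 1)) (KInvStep (d := d) Lc (i + 1))) Lc
                (unitS₂ (sfStep Lc i) (smStep d Lc i) (T2Of d Lc cE cVH cΛ cE₂ cB Tc (vh₂S d Lc) mixFF i)) -
              lin4 (cE₂ * (Lc : ℝ) ^ (2 * (d + 1))) (unitK (sfStep Lc i) (smStep d Lc i) (KInvStep (d := d) Lc i)) Lc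
                    (unitS₂ (sfStep Lc i) (smStep d Lc i) (T2Of d Lc cE cVH cΛ cE₂ cB Tc (vh₂S d Lc) mixFF i))) +
            ((fun κ u κ' u' => (cE₂ * (Lc : ℝ) ^ (2 * (d + 1))) • mmRead Lc (K3OfK
                  (unitK (sfStep Lc (i + 1)) (smStep d Lc (i + 1)) (KInvStep (d := d) Lc (i + 1))) Lc
                  (unitS (sfStep Lc (i + 1)) (smStep d Lc (i + 1)) (Spure d Lc cE cVH cΛ (i + 1)))
                  (unitM (sfStep Lc (i + 1)) (smStep d Lc (i + 1)) (M1 d Lc cΛ (i + 1))) (W2SymOfK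
                  (unitK (sfStep Lc (i + 1)) (smStep d Lc (i + 1)) (KInvStep (d := d) Lc (i + 1))) Lc
                  (unitS (sfStep Lc (i + 1)) (smStep d Lc (i + 1)) (Spure d Lc cE cVH cΛ (i + 1)))
                  (unitM (sfStep Lc (i + 1)) (smStep d Lc (i + 1)) (M1 d Lc cΛ (i + 1))) 0
                  (unitM₂ (sfStep Lc (i + 1)) (smStep d Lc (i + 1)) (M2Of d Lc mixFF (i + 1)))) κ u κ' u') + cB • mfNeg ((vh₂S d Lc) κ u κ' u')) -
                  (fun κ u κ' u' => (cE₂ * (Lc : ℝ) ^ (2 * (d + 1))) • mmRead Lc (K3OfK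
                  (unitK (sfStep Lc i) (smStep d Lc i) (KInvStep (d := d) Lc i)) Lc (unitS (sfStep Lc i) (smStep d Lc i) (Spure d Lc cE cVH cΛ i))
                  (unitM (sfStep Lc i) (smStep d Lc i) (M1 d Lc cΛ i)) (W2SymOfK (unitK (sfStep Lc i) (smStep d Lc i) (KInvStep (d := d) Lc i)) Lc
                  (unitS (sfStep Lc i) (smStep d Lc i) (Spure d Lc cE cVH cΛ i)) (unitM (sfStep Lc i) (smStep d Lc i) (M1 d Lc cΛ i)) 0
                  (unitM₂ (sfStep Lc i) (smStep d Lc i) (M2Of d Lc mixFF i))) κ u κ' u') + cB • mfNeg ((vh₂S d Lc) κ u κ' u')))) :=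
  unitS₂_T2Of_sub_eq_transport_add_sum cE cVH cΛ cE₂ cB Tc (vh₂S d Lc) mixFF (vh₂S_inl_inl Lc) (vh₂S_inr_inr Lc)
    (step_data_of_shapes hLc cE cVH cΛ cE₂ cB Tc ⟨_, 1, one_pos, locStencil₂_vh₂S hLc zero_le_one⟩ hmix)
    (bdd₄_unitS₂_T2Of_of_shapes hLc cE cVH cΛ cE₂ cB Tc ⟨_, 1, one_pos, locStencil₂_vh₂S hLc zero_le_one⟩ hmix) n

end OfShapes


end Summit.QuantumFields.BalabanUV.Beta.GAN24.T2UnitSplitShapes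

end
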